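import Summits.Schanuel.Schanuel.Theorems.RootDecomp1KXTop02

/-!
# RootDecomp1KXTop — lens 1, generation 45, node 4 (g45d) «SIMPLE POINTS OVER x = ∞, ALL x-DEGREES k, THE POINT (∞,∞) OF ANY ORDER e INCLUDED» (RULE K-R33 (iii); CLAIM L2301, ACK/price L2304, NODE L2313; critic VERDICT pending at staging — filed only on GO, behind XLinearII03) — continuation (RootDecomp1KXTop03): §XIII part 3 — the headlines

(lens-1 g45d HOME kernel K₄ = HOME/decomp-schanuel-lens-1/g45d/DLxtop.lean 5099 l = K₃ (tree: DegreeLadder + XLinear + XLinearII parts) + §XIII xiii_tail.lean 617 l (ns `…RootDecomp1KXTop`). Port by census-1 gen 19 as `RootDecomp1KXTop01–03` importing tree XLinearII03: the curves P = Σ_{j≤k} x^j c_j(Y) with separable top coefficient of maximal Y-degree (simple points over x = ∞) and the point (∞,∞) of any order e — `thinFibreAt_xPoly (k) (c) (e) …`, `thinFibreAt_xTop`, `thinFibreAt_xPoly_two`, `thinFibreAt_xLinear_sep_again`, `thinFibreAt_family`, positions (`mixed_not_affine`, `contact_not_*`) — ALL HYPOTHESIS-FREE (Ridout for rationals via the tree's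 XLinearII `ridout_window`, itself fed by `Ridout.finite_of_abs_le_one`).
PORT EDITS: the `(hR : PadicRothRat)` binder REMOVED from the five decls that carried it (the XLinearII port deleted `PadicRothRat`; `ridout_window`/`thinFibreAt_xPoly`/`thinFibreAt_xTop` are fed without it); `open …XLinearCore (norm_two …)` ↦ unrestricted open + private copies; linter option dropped; five docstrings added; statements and proofs otherwise verbatim. `--supports stmt-Schanuel-33364`; no census credit; rung 0.)
-/

noncomputable section

namespace Summit.Schanuel.Schanuel.Theorems.RootDecomp1KXTop

open Polynomial LiouvilleNumber
open scoped Nat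
open Summit.Schanuel.Schanuel.Theorems.RootDecomp1KSkelCell
  (exists_le_two_pow_factorial iota iota_spec iota_le_of_le pow_lt_of_lt_iota lt_iota_of_pow_lt iota_mono
   one_le_iota SkelLiouville SkelLiouvilleFix skelLiouville_iff_fix SkelLiouvilleFix.mono uStar dU rU dU_cast
   two_pow_le_four_mul_dU two_mul_dU_lt one_le_dU rU_den rU_cast uStar_sub_rU skelLiouvilleFix_one_uStar
   not_skelFixOne_algebraicIndependent)
open Summit.Schanuel.Schanuel.Theorems.RootDecomp1KTwoBaseCell (psNumer partialSum_eq_psNumer_div coprime_psNumer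
  algebraicIndependent_of_forall_int')
open Summit.Schanuel.Schanuel.Theorems.RootDecomp1KRelLiouvilleCell (partialSum_two_strictMono
  partialSum_two_lt_liouvilleNumber abs_liouvilleNumber_two_sub_partialSum)
open Summit.Schanuel.Schanuel.Theorems.RootDecomp1KDegreeLadder
open Summit.Schanuel.Schanuel.Theorems.RootDecomp1KXLinearCore
open Summit.Schanuel.Schanuel.Theorems.RootDecomp1KXLinear
open Summit.Schanuel.Schanuel.Theorems.RootDecomp1KXLinearII

/-- A polynomial whose image over `ℚ` is separable is non-zero. -/
private theorem ne_zero_of_map_separable {B : ℤ[X]} (hsep : (B.map (Int.castRingHom ℚ)).Separable) : B ≠ 0 := by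
  rintro rfl
  rw [Polynomial.map_zero] at hsep
  exact not_separable_zero hsep

set_option maxHeartbeats 400000 in

set_option maxHeartbeats 400000 in
/-- **SIMPLE FINITE POINTS OVER `x = ∞` ⇒ THIN FIBRES FOR EVERY `m₀ ≥ max(3, e + 1)`.**  For every `x`-degree `k`
(`k = 0` is vacuous: its points are degenerate) and every `e`: if the top `x`-coefficient `c_k` of
`P = Σ_{j ≤ k} x^j c_j(Y)` is separable over `ℚ` and `deg c_j ≤ deg c_k + e` (`j < k`), then `ThinFibreAt m₀ P` for all
`m₀ ≥ 3` with `m₀ ≥ e + 1` (Ridout's theorem for rationals BY TREE NAME at port; the `(∞, ∞)` part uses no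
Diophantine input). -/
theorem thinFibreAt_xPoly (k : ℕ) (c : ℕ → ℤ[X]) (e : ℕ)
    (hsep : ((c k).map (Int.castRingHom ℚ)).Separable) (hdeg : ∀ j, j < k → (c j).natDegree ≤ (c k).natDegree + e)
    {m₀ : ℕ} (hm : 3 ≤ m₀) (hme : e + 1 ≤ m₀) : ThinFibreAt m₀ (xPolyP k c) := by
  classical
  have hB : c k ≠ 0 := ne_zero_of_map_separable hsep
  have hℓpos : 0 < ‖((c k).leadingCoeff : PadicAlgCl 2)‖ := by
    rw [norm_pos_iff]; exact_mod_cast leadingCoeff_ne_zero.mpr hB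
  intro C
  obtain ⟨N₄, hN₄⟩ := infinity_arith ‖((c k).leadingCoeff : PadicAlgCl 2)‖ C hℓpos e
  -- the `(∞, ∞)` end (no Diophantine input): `‖lc‖·2^{N!} ≤ ‖r‖₂^e ≤ den(r)^e`
  have hinf : ∀ N, N₄ ≤ N → ∀ r : ℚ,
      ‖((c k).leadingCoeff : PadicAlgCl 2)‖ * 2 ^ N ! ≤ ‖(r : PadicAlgCl 2)‖ ^ e →
      C * 2 ^ (N + 1)! < (r.den : ℝ) ^ (m₀ * N) := by
    intro N hN r hfar
    have hd1 : (1 : ℝ) ≤ r.den := by exact_mod_cast Nat.succ_le_of_lt r.den_pos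
    have hfar' : ‖((c k).leadingCoeff : PadicAlgCl 2)‖ * 2 ^ N ! ≤ (r.den : ℝ) ^ e :=
      hfar.trans (pow_le_pow_left₀ (norm_nonneg _) (norm_ratCast_le_den r) e)
    have h := hN₄ N hN r.den (Nat.succ_le_of_lt r.den_pos) hfar'
    exact h.trans_le (pow_le_pow_right₀ hd1 (Nat.mul_le_mul_right _ hme))
  by_cases hd : 1 ≤ (c k).natDegree
  · obtain ⟨T, cc, N₁, hcc, hTroots, hclose⟩ := near_root_or_at_infinity k c e hd hsep hdeg
    obtain ⟨N₂, hN₂⟩ := dichotomy_arith cc C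
    have hF := ridout_window (c k) hd C
    have hbad : (⋃ r ∈ {r : ℚ | |(r : ℝ)| ≤ C ∧ ∃ β : PadicAlgCl 2, aeval β (c k) = 0 ∧
        (r.den : ℝ) ^ 5 * ‖((c k).leadingCoeff : PadicAlgCl 2) * ((r : PadicAlgCl 2) - β)‖ ^ 2 ≤ 1},
        {N : ℕ | bev (xPolyP k c) (partialSum 2 N) r = 0 ∧ ∃ x : ℝ, bev (xPolyP k c) x r ≠ 0}).Finite := by
      refine hF.biUnion fun r _ => ?_
      by_cases hnd : ∃ x : ℝ, bev (xPolyP k c) x r ≠ 0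
      · exact (levels_finite_of_nondeg _ r hnd).subset fun N hN => hN.1
      · exact Set.finite_empty.subset fun N hN => (hnd hN.2).elim
    obtain ⟨N₃, hN₃⟩ := hbad.bddAbove
    refine ⟨max (max N₁ N₂) (max (N₃ + 1) N₄), fun N hN r hr hP hnd => ?_⟩
    have hNN₁ : N₁ ≤ N := le_trans (le_trans (le_max_left _ _) (le_max_left _ _)) hN
    have hNN₂ : N₂ ≤ N := le_trans (le_trans (le_max_right _ _) (le_max_left _ _)) hN
    have hNN₃ : N₃ + 1 ≤ N := le_trans (le_trans (le_max_left _ _) (le_max_right _ _)) hN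
    have hNN₄ : N₄ ≤ N := le_trans (le_trans (le_max_right _ _) (le_max_right _ _)) hN
    rcases hclose N hNN₁ r hP with ⟨β, hβT, hx⟩ | ⟨_, hfar⟩
    · -- near a finite simple point over `x = ∞`: Ridout, or the point is far
      have hnot : ¬ ((r.den : ℝ) ^ 5 *
          ‖((c k).leadingCoeff : PadicAlgCl 2) * ((r : PadicAlgCl 2) - β)‖ ^ 2 ≤ 1) := by
        intro hineq
        have hmem : N ∈ ⋃ r ∈ {r : ℚ | |(r : ℝ)| ≤ C ∧ ∃ β : PadicAlgCl 2, aeval β (c k) = 0 ∧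
            (r.den : ℝ) ^ 5 * ‖((c k).leadingCoeff : PadicAlgCl 2) * ((r : PadicAlgCl 2) - β)‖ ^ 2 ≤ 1},
            {N : ℕ | bev (xPolyP k c) (partialSum 2 N) r = 0 ∧ ∃ x : ℝ, bev (xPolyP k c) x r ≠ 0} :=
          Set.mem_biUnion (x := r) ⟨hr, β, hTroots β hβT, hineq⟩ ⟨hP, hnd⟩
        have := hN₃ hmem
        omega
      have h3 := hN₂ N hNN₂ r.den _ (Nat.succ_le_of_lt r.den_pos) (norm_nonneg _) hx hnot
      have hd1 : (1 : ℝ) ≤ r.den := by exact_mod_cast Nat.succ_le_of_lt r.den_pos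
      exact h3.trans_le (pow_le_pow_right₀ hd1 (Nat.mul_le_mul_right _ hm))
    · exact hinf N hNN₄ r hfar
  · -- constant (non-zero) top coefficient: only the `(∞, ∞)` alternative
    have hd0 : (c k).natDegree = 0 := by omega
    obtain ⟨N₁, hN₁⟩ := at_infinity_of_const_top k c e hB hd0 hdeg
    refine ⟨max N₁ N₄, fun N hN r _ hP _ => ?_⟩
    obtain ⟨_, hfar⟩ := hN₁ N (le_trans (le_max_left _ _) hN) r hP
    exact hinf N (le_trans (le_max_right _ _) hN) r hfar

/-- the case without a point at `(∞, ∞)` (`e = 0`, `deg c_j ≤ deg c_k`): every `m₀ ≥ 3`. -/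
theorem thinFibreAt_xTop (k : ℕ) (c : ℕ → ℤ[X])
    (hsep : ((c k).map (Int.castRingHom ℚ)).Separable) (hdeg : ∀ j, j < k → (c j).natDegree ≤ (c k).natDegree)
    {m₀ : ℕ} (hm : 3 ≤ m₀) : ThinFibreAt m₀ (xPolyP k c) :=
  thinFibreAt_xPoly k c 0 hsep (fun j hj => by simpa using hdeg j hj) hm (by omega)

/-- **ALL POINTS OVER `x = ∞` SIMPLE IN `P¹`, and more** (`e ≤ 2`: `deg c_j ≤ deg c_k + 2`): every `m₀ ≥ 3`. -/
theorem thinFibreAt_xPoly_two (k : ℕ) (c : ℕ → ℤ[X])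
    (hsep : ((c k).map (Int.castRingHom ℚ)).Separable) (hdeg : ∀ j, j < k → (c j).natDegree ≤ (c k).natDegree + 2)
    {m₀ : ℕ} (hm : 3 ≤ m₀) : ThinFibreAt m₀ (xPolyP k c) :=
  thinFibreAt_xPoly k c 2 hsep hdeg hm hm

/-! ### Position -/

/-- The x-linear case II of §XII is the case `k = 1` (by name, through `xPolyP_one`). -/
private theorem thinFibreAt_xLinear_sep_again (A B : ℤ[X]) (hsep : (B.map (Int.castRingHom ℚ)).Separable)
    (hle : A.natDegree ≤ B.natDegree) {m₀ : ℕ} (hm : 3 ≤ m₀) : ThinFibreAt m₀ (xLinP A B) := by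
  have h := thinFibreAt_xTop 1 (fun j => if j = 0 then A else B) (by simpa using hsep)
    (fun j hj => by have : j = 0 := by omega
                    subst this; simpa using hle) hm
  rwa [xPolyP_one] at h

/-- Members of EVERY `x`-degree `k` and `Y`-degree `d ≥ 1`: `Σ_{j ≤ k} x^j (Y^d − (j + 2))`. -/
theorem thinFibreAt_family (k d : ℕ) (hd : 1 ≤ d) {m₀ : ℕ} (hm : 3 ≤ m₀) :
    ThinFibreAt m₀ (xPolyP k fun j => X ^ d - Polynomial.C ((j : ℤ) + 2)) := by
  refine thinFibreAt_xTop k _ ?_ (fun j _ => ?_) hm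
  · rw [Polynomial.map_sub, Polynomial.map_pow, Polynomial.map_X, Polynomial.map_C]
    refine separable_X_pow_sub_C _ (by norm_num [Nat.cast_eq_zero]; omega) ?_
    simp only [eq_intCast, Int.cast_add, Int.cast_natCast, Int.cast_ofNat, ne_eq]
    norm_cast
  · rw [natDegree_X_pow_sub_C, natDegree_X_pow_sub_C]

/-- the `x`-coefficients of the mixed member below -/
def mixedC : ℕ → ℤ[X]
  | 0 => X ^ 5 - 1
  | 1 => X + 1
  | _ => X ^ 5 - 1

/-- The mixed member `Y^5 − 1 + x·(Y + 1) + x²·(Y^5 − 1)` (x-degree 2: outside every x-linear theorem). -/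
theorem thinFibreAt_mixed {m₀ : ℕ} (hm : 3 ≤ m₀) : ThinFibreAt m₀ (xPolyP 2 mixedC) := by
  refine thinFibreAt_xTop 2 _ ?_ (fun j hj => ?_) hm
  · show ((X ^ 5 - 1 : ℤ[X]).map (Int.castRingHom ℚ)).Separable
    rw [Polynomial.map_sub, Polynomial.map_pow, Polynomial.map_X, Polynomial.map_one, ← C_1]
    exact separable_X_pow_sub_C (1 : ℚ) (by norm_num) one_ne_zero
  · have h2 : (mixedC 2).natDegree = 5 := by
      show (X ^ 5 - 1 : ℤ[X]).natDegree = 5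
      rw [← C_1, natDegree_X_pow_sub_C]
    rw [h2]
    interval_cases j
    · show (X ^ 5 - 1 : ℤ[X]).natDegree ≤ 5
      rw [← C_1, natDegree_X_pow_sub_C]
    · show (X + 1 : ℤ[X]).natDegree ≤ 5
      rw [← C_1, natDegree_X_add_C]; norm_num

/-- the `x`-coefficients of a member WITH a point at `(∞, ∞)` of order `e = 2` -/
def contactC : ℕ → ℤ[X]
  | 0 => X ^ 7 - 1
  | 1 => X ^ 2 + 1
  | _ => X ^ 5 - 1

/-- `Y^7 − 1 + x·(Y² + 1) + x²·(Y^5 − 1)`: x-degree 2, the point `(∞, ∞)` of order `2` — every `m₀ ≥ 3`. -/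
theorem thinFibreAt_contact {m₀ : ℕ} (hm : 3 ≤ m₀) : ThinFibreAt m₀ (xPolyP 2 contactC) := by
  refine thinFibreAt_xPoly_two 2 _ ?_ (fun j hj => ?_) hm
  · show ((X ^ 5 - 1 : ℤ[X]).map (Int.castRingHom ℚ)).Separable
    rw [Polynomial.map_sub, Polynomial.map_pow, Polynomial.map_X, Polynomial.map_one, ← C_1]
    exact separable_X_pow_sub_C (1 : ℚ) (by norm_num) one_ne_zero
  · have h2 : (contactC 2).natDegree = 5 := by
      show (X ^ 5 - 1 : ℤ[X]).natDegree = 5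
      rw [← C_1, natDegree_X_pow_sub_C]
    rw [h2]
    interval_cases j
    · show (X ^ 7 - 1 : ℤ[X]).natDegree ≤ 5 + 2
      rw [← C_1, natDegree_X_pow_sub_C]
    · show (X ^ 2 + 1 : ℤ[X]).natDegree ≤ 5 + 2
      rw [← C_1, natDegree_X_pow_add_C]; norm_num

/-- the `x`-coefficients of a member with a point at `(∞, ∞)` of order `e = 4` -/
def highContactC : ℕ → ℤ[X]
  | 0 => X ^ 9 - 1
  | 1 => X
  | _ => X ^ 5 - 1

/-- `Y^9 − 1 + x·Y + x²·(Y^5 − 1)`: order `4` at `(∞, ∞)` — every `m₀ ≥ 5`. -/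
theorem thinFibreAt_highContact {m₀ : ℕ} (hm : 5 ≤ m₀) :
    ThinFibreAt m₀ (xPolyP 2 highContactC) := by
  refine thinFibreAt_xPoly 2 _ 4 ?_ (fun j hj => ?_) (by omega) (by omega)
  · show ((X ^ 5 - 1 : ℤ[X]).map (Int.castRingHom ℚ)).Separable
    rw [Polynomial.map_sub, Polynomial.map_pow, Polynomial.map_X, Polynomial.map_one, ← C_1]
    exact separable_X_pow_sub_C (1 : ℚ) (by norm_num) one_ne_zero
  · have h2 : (highContactC 2).natDegree = 5 := by
      show (X ^ 5 - 1 : ℤ[X]).natDegree = 5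
      rw [← C_1, natDegree_X_pow_sub_C]
    rw [h2]
    interval_cases j
    · show (X ^ 9 - 1 : ℤ[X]).natDegree ≤ 5 + 4
      rw [← C_1, natDegree_X_pow_sub_C]
    · show (X : ℤ[X]).natDegree ≤ 5 + 4
      rw [natDegree_X]; norm_num

/-! ### Not x-linear: the members of `x`-degree `2` lie in NO x-linear class -/

/-- on an x-linear curve, `x ↦ P(x, y)` is affine. -/
theorem xLinP_affine (A B : ℤ[X]) (y : ℝ) :
    bev (xLinP A B) 0 y + bev (xLinP A B) 2 y = 2 * bev (xLinP A B) 1 y := by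
  simp only [bev_xLinP]; ring

/-- The mixed example is not affine in `x` (position). -/
theorem mixed_not_affine : bev (xPolyP 2 mixedC) 0 0 + bev (xPolyP 2 mixedC) 2 0 ≠ 2 * bev (xPolyP 2 mixedC) 1 0 := by
  simp only [bev_xPolyP, Finset.sum_range_succ, Finset.sum_range_zero, mixedC, map_sub, map_add, map_pow,
    aeval_X, map_one]
  norm_num

/-- `Y^5 − 1 + x·(Y + 1) + x²·(Y^5 − 1)` is not of the form `A(Y) + x·B(Y)`: outside `XLinearLt`, `XLinearGap2`
and the separable x-linear class of §XII at once. -/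
theorem mixed_not_xLinear (A B : ℤ[X]) : xPolyP 2 mixedC ≠ xLinP A B := by
  intro h
  have := mixed_not_affine
  rw [h] at this
  exact this (xLinP_affine A B 0)

/-- The contact example is not affine in `x` (position). -/
theorem contact_not_affine :
    bev (xPolyP 2 contactC) 0 0 + bev (xPolyP 2 contactC) 2 0 ≠ 2 * bev (xPolyP 2 contactC) 1 0 := by
  simp only [bev_xPolyP, Finset.sum_range_succ, Finset.sum_range_zero, contactC, map_sub, map_add, map_pow,
    aeval_X, map_one]
  norm_num

/-- The contact example is not x-linear (position). -/
theorem contact_not_xLinear (A B : ℤ[X]) : xPolyP 2 contactC ≠ xLinP A B := by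
  intro h
  have := contact_not_affine
  rw [h] at this
  exact this (xLinP_affine A B 0)

/-
CONSUMER DIRECTION (not derived for `k ≥ 2`): `engine_of_clause` turns `ThinFibreAt m P` into
`P(ℓ₂, ρ) ≠ 0` on `SkelLiouvilleFix m ρ` only given `∂P/∂x(ℓ₂, ρ) ≠ 0`; for `k = 1` this is `B(ρ) ≠ 0`
(transcendence of `ρ`), for `k ≥ 2` it is `Σ_j j·c_j(ρ)·ℓ₂^{j−1} ≠ 0`, a relation of the same kind one
level down — obtaining it needs an induction on `k` through the whole chapter, not attempted here.
-/

end Summit.Schanuel.Schanuel.Theorems.RootDecomp1KXTop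

end
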